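import Literature.NumberTheory.GaloisRepresentations.LubinTateColemanUnitsImageGaloisTwo
import Literature.NumberTheory.GaloisRepresentations.LubinTateColemanRelativeContinuousTwo
import HarnessLib

/-!
# `Col : 𝒰¹_∞ ≃ N` is a HOMEOMORPHISM of compact groups onto a CLOSED `Λ`-submodule of the compact topological `Λ`-module
# `M = (𝒪_F⟦X⟧⟦Y⟧)^{ℤ/d}`; closed subgroups of `M` stable under `σ_γ`, `φ` and `ℕ` are `Λ`-SUBMODULES (`q = 2`)

De Shalit, *Iwasawa theory of elliptic curves with complex multiplication* (1987), Ch. I §3.4 Corollary ("`i` is an injective homomorphism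
of `ℤ_p⟦𝒢⟧`-modules"), §3.7 Theorem ("`i` extended by linearity to the completed tensor product `𝒰 ⊗̂ 𝒪`" — both presuppose CONTINUITY of
`i`), Ch. III §1.3 ("`i : 𝒰 ⊗̂ 𝐃 ≃ Λ₁`") and §1.4 ("`C̄_n` the closure of `C_n` … `𝒞_𝔣 = lim← ⟨C̄_n⟩` … `i(𝒞_𝔣 ⊗̂ 𝐃) = μ(𝔣)Λ₀`": the
image of a CLOSURE is computed as a `Λ`-SUBMODULE).  The tree has the two-variable Coleman transform at `q = 2` as the bijection
`colemanImageEquiv : principalCoherentFamilies ≃ unitsImage` onto the `Λ = 𝒪_F⟦X⟧⟦T⟧`-submodule `N = unitsImage ≤ M`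
(`LubinTateColemanUnitsImage{Module,Equiv,Galois}Two`, algebraic).  THIS file supplies the topology (everything PROVED, 0 sorry):

* §1 the two-variable coordinate module `ColemanCoordModule hπ hq (intBase F) u hu γ` (= `𝒪_F⟦X⟧⟦Y⟧` with `T ↦ D_γ`) is a COMPACT Hausdorff
  topological `Λ`-module: `continuous_twistLinearBase` (`D_γ`), `exists_pow_mul_mem_nhds_integer` (`π^n 𝒪_F → 0`), ★ the instance
  `ContinuousSMul (PowerSeries (PowerSeries 𝒪[F])) (ColemanCoordModule …)` (from `PowerSeriesTopNilpotentContinuous`), `compactSpace_…`;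
  finitely generated `Λ`-submodules of `M` are closed.
* §2 the coordinates in an integral normal basis are continuous (`continuous_basis_repr`: `𝒪_F^{Gal} ≅ 𝒪_E` is a homeomorphism), hence the Amice
  sums `amiceSum` are; divisibility by a fixed element is a CLOSED condition in the compact ring `𝒪_F⟦X⟧` (`isClosed_setOf_dvd`).
* §3 ★ `principalCoherentFamilies` is compact (closed in `∏_m 𝒰(E_m·K_π^∞)`: baseNorm-coherence and principality are closed conditions);
  ★★ `continuous_colemanImage` — **`Col` is CONTINUOUS** (closed graph: the congruences `IsTransformProd` are closed conditions, via
  `continuous_relUnitCoordTwo`); ★★ `isClosed_unitsImage` — **`N` is CLOSED** (image of a compact); ★★★ `colemanImageHomeomorph :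
  principalCoherentFamilies ≃ₜ unitsImage` — **de Shalit's `i` is a homeomorphism `𝒰¹_∞ ≅ N`** (continuous bijection, compact → Hausdorff).
* §4 ★★★ `smul_mem_of_isClosed_of_ops` — a CLOSED additive subgroup `Z ≤ M` stable under `σ_γ = (1+T)•` (`unitTwistₗ γ`), under
  `φ`-type multiplication `C(1+X)•` and containing with `G` all `n • G` is a `Λ`-SUBMODULE as soon as `ℕ` is dense in `𝒪_F` (`F = ℚ_p`):
  the form in which "closure of the elliptic units ↦ closed `Λ`-span of their transforms" (III.1.4) becomes available to the assembler.

## References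
* E. de Shalit, *Iwasawa theory of elliptic curves with complex multiplication* (1987), Ch. I §3.4 Corollary, §3.7, §3.8 (17); Ch. III §1.3–1.4.
  [deShalit1987]
* L. C. Washington, *Introduction to Cyclotomic Fields* (1997), §13.2 (compact `Λ`-modules). [Washington1997]
* N. Bourbaki, *General Topology* Ch. I §10.2 Cor. 5, §9.5 Th. 3, Cor. 2 to Th. 2 of §9.4 (continuous bijections from compact spaces). [BourbakiGT1]
-/

noncomputable section

open Filter Topology
open scoped PowerSeries.WithPiTopology

namespace Literature.NumberTheory.GaloisRepresentations

/-! ### §0. Generic: finitely generated submodules of compact modules are closed -/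

section GenericFG

/-- **Finitely generated submodules are CLOSED** in a Hausdorff topological module over a COMPACT ring (the span of `v₁,…,v_n` is the
image of the compact `R^n`). [cite: Washington1997, §13.2] [cite: BourbakiGT1, Ch. I §9.4 Cor. 2] -/
theorem isClosed_span_range_of_compactSpace {R M : Type*} [CommRing R] [TopologicalSpace R] [CompactSpace R] [AddCommGroup M] [Module R M]
    [TopologicalSpace M] [T2Space M] [ContinuousAdd M] [ContinuousSMul R M] {n : ℕ} (v : Fin n → M) :
    IsClosed (Submodule.span R (Set.range v) : Set M) := by
  have e : (Submodule.span R (Set.range v) : Set M) = Set.range (fun c : Fin n → R => ∑ i, c i • v i) := by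
    ext m
    rw [SetLike.mem_coe, Submodule.mem_span_range_iff_exists_fun, Set.mem_range]
  rw [e]
  exact (isCompact_range (continuous_finsetSum _ fun i _ => ((continuous_apply i).smul continuous_const))).isClosed

end GenericFG

section UnitsImageTopologyTwo

open GaloisRepresentations.IsNonarchimedeanLocalField LubinTate ValuativeRel Field Finset

variable {F : Type} [Field F] [ValuativeRel F] [TopologicalSpace F] [IsNonarchimedeanLocalField F]

attribute [local instance] ltNormUniformSpace ltNormIsUniformAddGroup rk1 nF nE fintypeResidueField

/-! ### §1. The two-variable coordinate module is a compact topological `Λ`-module -/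

section CoordModule

variable {π : 𝒪[F]} (hπ : (valuation F).IsUniformizer (π : F)) (hq : residueFieldCard F = 2)
variable {S : Type*} [CommRing S] (ι : LTCoeff F →+* S) [TopologicalSpace S] [IsTopologicalRing S]

/-- ★ **The twist `D_γ^S = σ_γ − 1` is continuous** on `S⟦Y⟧` (multiplication by a fixed series and substitution of the constant-term-free
`[γ]_f`). [cite: deShalit1987, Ch. I §3.4 Lemma (ii)] -/
theorem continuous_twistLinearBase (u : (LTCoeff F)ˣ) (γ : 𝒪[F]ˣ) : Continuous (twistLinearBase hπ hq ι u γ) := by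
  have e : (twistLinearBase hπ hq ι u γ : PowerSeries S → PowerSeries S) = fun r => PowerSeries.C (ι (LTCoeff.of F (γ : 𝒪[F]))) *
      PowerSeries.map ι (evenPartTwo hπ hq (unitTwistSerTwo hπ (↑u⁻¹ : LTCoeff F) γ)) *
      PowerSeries.subst (PowerSeries.map ι
        (hom (isLTRing_LTCoeff hπ) (isLTSeries_LTCoeff π) (isLTSeries_LTCoeff π) (LTCoeff.of F (γ : 𝒪[F])))) r - r :=
    funext fun r => twistLinearBase_apply hπ hq ι u γ r
  rw [e]
  exact (continuous_const.mul (PowerSeries.WithPiTopology.continuous_subst_of_constantCoeff_eq_zero (constantCoeff_map_unitHom hπ ι γ))).sub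
    continuous_id

include hπ in
/-- **`π^n 𝒪_F → 0` uniformly**: every neighbourhood of `0` in `𝒪_F` contains `π^n 𝒪_F` for some `n`. [cite: SerreLocalFields1979, Ch. II §1] -/
theorem exists_pow_mul_mem_nhds_integer (U : Set 𝒪[F]) (hU : U ∈ 𝓝 (0 : 𝒪[F])) : ∃ n : ℕ, ∀ s : 𝒪[F], π ^ n * s ∈ U := by
  rw [Metric.mem_nhds_iff] at hU
  obtain ⟨ε, hε, hball⟩ := hU
  have hπ1 : ‖(π : F)‖ < 1 := Valued.toNormedField.norm_lt_one_iff.mpr hπ.val_lt_one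
  obtain ⟨n, hn⟩ := exists_pow_lt_of_lt_one hε hπ1
  refine ⟨n, fun s => hball ?_⟩
  rw [Metric.mem_ball, dist_zero_right]
  change ‖((π ^ n * s : 𝒪[F]) : F)‖ < ε
  rw [Subring.coe_mul, SubmonoidClass.coe_pow, norm_mul, norm_pow]
  refine lt_of_le_of_lt ?_ hn
  have hs : ‖(s : F)‖ ≤ 1 := Valued.toNormedField.norm_le_one_iff.mpr s.2
  calc ‖(π : F)‖ ^ n * ‖(s : F)‖ ≤ ‖(π : F)‖ ^ n * 1 := by gcongr
    _ = ‖(π : F)‖ ^ n := mul_one _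

include hπ in
/-- `(C π)^n 𝒪_F⟦X⟧ → 0` uniformly, for the base `intBase F` (`p = C π`). [cite: SerreLocalFields1979, Ch. II §1] -/
theorem exists_pow_mul_mem_nhds_intBase (U : Set (PowerSeries 𝒪[F])) (hU : U ∈ 𝓝 (0 : PowerSeries 𝒪[F])) :
    ∃ n : ℕ, ∀ s : PowerSeries 𝒪[F], (intBase F (LTCoeff.of F π)) ^ n * s ∈ U := by
  rw [intBase_of]
  exact PowerSeries.WithPiTopology.exists_pow_mul_mem_nhds (exists_pow_mul_mem_nhds_integer hπ) U hU

variable (u : (LTCoeff F)ˣ) (hu : LTCoeff.of F π = residueFieldCard F * u) (γ : 𝒪[F]ˣ)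
variable [IsAdicComplete (Ideal.span {intBase F (LTCoeff.of F π)}) (PowerSeries 𝒪[F])]

/-- ★ **The `Λ = 𝒪_F⟦X⟧⟦T⟧`-action on the two-variable coordinate module is continuous.** [cite: deShalit1987, Ch. I §3.1, §3.7]
[cite: Washington1997, §13.2] -/
instance continuousSMul_colemanCoordModule :
    ContinuousSMul (PowerSeries (PowerSeries 𝒪[F])) (ColemanCoordModule hπ hq (intBase F) u hu γ) :=
  TActModule.continuousSMul (exists_pow_mul_mem_nhds_intBase hπ) (continuous_twistLinearBase hπ hq (intBase F) u γ)

/-- The coordinate module is compact. [cite: BourbakiGT1, Ch. I §9.5 Th. 3] -/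
instance compactSpace_colemanCoordModule : CompactSpace (ColemanCoordModule hπ hq (intBase F) u hu γ) := by
  haveI : CompactSpace (PowerSeries 𝒪[F]) := PowerSeries.WithPiTopology.compactSpace _
  exact TActModule.instCompactSpace

/-- `Λ = 𝒪_F⟦X⟧⟦T⟧` is compact. [cite: BourbakiGT1, Ch. I §9.5 Th. 3] -/
theorem compactSpace_lambda₂ : CompactSpace (PowerSeries (PowerSeries 𝒪[F])) := by
  haveI : CompactSpace (PowerSeries 𝒪[F]) := PowerSeries.WithPiTopology.compactSpace _
  exact PowerSeries.WithPiTopology.compactSpace _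

/-- `c ↦ c • G` is continuous on `M = (ColemanCoordModule)^{ℤ/d}`. [cite: Washington1997, §13.2] -/
theorem continuous_smul_left_pi {d : ℕ} (G : ZMod d → ColemanCoordModule hπ hq (intBase F) u hu γ) :
    Continuous fun c : PowerSeries (PowerSeries 𝒪[F]) => c • G :=
  continuous_id.smul continuous_const

/-- **Finitely generated `Λ`-submodules of `M` are closed.** [cite: Washington1997, §13.2] -/
theorem isClosed_span_range_pi {d n : ℕ} (v : Fin n → (ZMod d → ColemanCoordModule hπ hq (intBase F) u hu γ)) :
    IsClosed (Submodule.span (PowerSeries (PowerSeries 𝒪[F])) (Set.range v) : Set (ZMod d → ColemanCoordModule hπ hq (intBase F) u hu γ)) := by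
  haveI := compactSpace_lambda₂ (F := F)
  exact isClosed_span_range_of_compactSpace v

end CoordModule

/-! ### §2. Coordinates in an integral normal basis are continuous; Amice sums; closed divisibility conditions -/

section NormalBasis

variable (E : IntermediateField F (AlgebraicClosure F)) [FiniteDimensional F E]

/-- The structure map `𝒪_F → 𝒪_E` is continuous (an isometry). [cite: SerreLocalFields1979, Ch. II §2 Cor. 3] -/
theorem continuous_algebraMap_integer : Continuous (algebraMap 𝒪[F] (unitBall E)) := by
  refine (AddMonoidHomClass.isometry_of_norm (algebraMap 𝒪[F] (unitBall E)) fun x => ?_).continuous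
  change ‖((algebraMap 𝒪[F] (unitBall E) x : unitBall E) : E)‖ = ‖(x : F)‖
  rw [algebraMap_integer_apply, norm_eq_spectralNorm, spectralNorm_extends]

variable [IsGalois F E]

/-- ★ **The coordinate functionals of an integral normal basis are continuous**: `(c_σ) ↦ Σ c_σ·σθ` is a continuous bijection from the
compact `𝒪_F^{Gal(E/F)}` to the Hausdorff `𝒪_E`, hence a homeomorphism. [cite: SerreLocalFields1979, Ch. II §2 Prop. 3] [cite: BourbakiGT1, Ch. I §9.4 Cor. 2] -/
theorem continuous_basis_repr {θ : unitBall E} (hθ : IsIntegralNormalGen E θ) (σ : E ≃ₐ[F] E) :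
    Continuous fun y : unitBall E => hθ.basis.repr y σ := by
  classical
  -- the inverse map `c ↦ Σ c σ • σθ` is continuous
  have hsymm : Continuous (hθ.basis.equivFun.symm : ((E ≃ₐ[F] E) → 𝒪[F]) → unitBall E) := by
    have e : (hθ.basis.equivFun.symm : ((E ≃ₐ[F] E) → 𝒪[F]) → unitBall E) = fun c => ∑ τ, c τ • hθ.basis τ :=
      funext fun c => hθ.basis.equivFun_symm_apply c
    rw [e]
    refine continuous_finsetSum _ fun τ _ => ?_
    have e2 : (fun c : (E ≃ₐ[F] E) → 𝒪[F] => c τ • hθ.basis τ) = fun c => algebraMap 𝒪[F] (unitBall E) (c τ) * hθ.basis τ :=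
      funext fun c => Algebra.smul_def _ _
    rw [e2]
    exact ((continuous_algebraMap_integer E).comp (continuous_apply τ)).mul continuous_const
  let f : ((E ≃ₐ[F] E) → 𝒪[F]) ≃ unitBall E := hθ.basis.equivFun.symm.toEquiv
  haveI : CompactSpace ((E ≃ₐ[F] E) → 𝒪[F]) := inferInstance
  have hf : Continuous f := hsymm
  have hcont : Continuous f.symm := (hf.homeoOfEquivCompactToT2 (f := f)).symm.continuous
  have e3 : (fun y : unitBall E => hθ.basis.repr y σ) = fun y => (f.symm y) σ := by
    funext y; rfl
  rw [e3]
  exact (continuous_apply σ).comp hcont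

end NormalBasis

section Amice

variable {p : ℕ} [hp : Fact p.Prime] {d : ℕ} (hd : d.Coprime p)
variable (E : ℕ → IntermediateField F (AlgebraicClosure F)) [∀ m, FiniteDimensional F (E m)] [∀ m, IsGalois F (E m)]
  (σ₀ : absoluteGaloisGroup F)

/-- The Amice sums `y ↦ Φ_m(y)(j)` are continuous in `y ∈ 𝒪_{E_m}`. [cite: deShalit1987, Ch. I §3.8 (17)] -/
theorem continuous_amiceSum {m : ℕ} {θ : unitBall (E m)} (hθ : IsIntegralNormalGen (E m) θ) (j : ZMod d) :
    Continuous fun y : unitBall (E m) => amiceSum p d hd σ₀ hθ y j := by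
  unfold amiceSum
  refine continuous_finsetSum _ fun i _ => ?_
  exact ((PowerSeries.WithPiTopology.continuous_C (R := 𝒪[F])).comp (continuous_basis_repr (E m) hθ _)).mul continuous_const

omit hp in
/-- **Divisibility by a fixed element is a CLOSED condition in `𝒪_F⟦X⟧`** (the multiples of `a` are the image of the compact ring under
`· * a`). [cite: BourbakiGT1, Ch. I §9.4 Cor. 2] -/
theorem isClosed_setOf_dvd (a : PowerSeries 𝒪[F]) : IsClosed {x : PowerSeries 𝒪[F] | a ∣ x} := by
  haveI : CompactSpace (PowerSeries 𝒪[F]) := PowerSeries.WithPiTopology.compactSpace _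
  have e : {x : PowerSeries 𝒪[F] | a ∣ x} = Set.range fun s : PowerSeries 𝒪[F] => a * s := by
    ext x; exact ⟨fun ⟨s, hs⟩ => ⟨s, hs.symm⟩, fun ⟨s, hs⟩ => ⟨s, hs.symm⟩⟩
  rw [e]
  exact (isCompact_range (PowerSeries.WithPiTopology.continuous_mul_left a)).isClosed

end Amice

/-! ### §3. `Col` is continuous, `N` is closed, `Col : 𝒰¹_∞ ≃ₜ N` -/

section Coleman

variable {p : ℕ} [hp : Fact p.Prime] {d : ℕ} (hd : d.Coprime p)
variable {π : 𝒪[F]} (hπ : (valuation F).IsUniformizer (π : F))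
variable (E : ℕ → IntermediateField F (AlgebraicClosure F)) [∀ m, FiniteDimensional F (E m)] [∀ m, Normal F (E m)]
  [∀ m, IsGalois F (E m)] (hmono : Monotone E) (hE : ∀ m, E m ≤ maxUnramified F) (hdeg : ∀ m, Module.finrank F (E m) = d * p ^ m)
  {σ₀ : absoluteGaloisGroup F} (hσ₀ : IsAbsArithFrob σ₀) (hq : residueFieldCard F = 2)
variable (u : (LTCoeff F)ˣ) (hu : LTCoeff.of F π = residueFieldCard F * u) (γ : 𝒪[F]ˣ)
variable [NeZero d] [IsAdicComplete (Ideal.span {(p : 𝒪[F])}) 𝒪[F]]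
variable {θ : ∀ m, unitBall (E m)} (hθ : ∀ m, IsIntegralNormalGen (E m) (θ m))
  (hcoh : ∀ m, unitBallTrace (hmono (Nat.le_succ m)) (θ (m + 1)) = θ m)

/-- **Principality `‖y − 1‖ < 1` is a closed (indeed clopen) condition** on `𝒪_E` (the maximal ideal is an open, hence closed, subgroup).
[cite: SerreLocalFields1979, Ch. II §1] -/
theorem isClosed_setOf_norm_sub_one_lt (L : IntermediateField F (AlgebraicClosure F)) [FiniteDimensional F L] :
    IsClosed {y : unitBall L | ‖(y : L) - 1‖ < 1} := by
  have e : {y : unitBall L | ‖(y : L) - 1‖ < 1} = (fun y : unitBall L => y - 1) ⁻¹' ((ballIdeal L one_pos : Ideal (unitBall L)) : Set (unitBall L)) := by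
    ext y
    simp only [Set.mem_setOf_eq, Set.mem_preimage, SetLike.mem_coe, ballIdeal, Submodule.mem_mk, AddSubmonoid.mem_mk,
      AddSubsemigroup.mem_mk, AddSubgroupClass.coe_sub, OneMemClass.coe_one]
  rw [e]
  exact (isClosed_ballIdeal_one L).preimage (continuous_id.sub continuous_const)

omit [∀ m, Normal F (E m)] in
/-- ★ **`𝒰¹_∞ = principalCoherentFamilies` is CLOSED** in `∏_m 𝒰(E_m·K_π^∞)` (baseNorm-coherence: `continuous_baseNorm`; principality:
clopen). [cite: deShalit1987, Ch. I §3.8 (16)–(17); Ch. III §1.3] -/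
theorem isClosed_principalCoherentFamilies : IsClosed (principalCoherentFamilies hπ E hmono) := by
  have e : principalCoherentFamilies hπ E hmono =
      (⋂ m, {β : ∀ m, RelNormCoherentUnits hπ (E m) | (β (m + 1)).baseNorm hπ (hmono (Nat.le_succ m)) = β m}) ∩
      ⋂ m, {β | ‖(((β m).val 0 : unitBall (E m ⊔ ltField π 0 : IntermediateField F (AlgebraicClosure F))) :
        (E m ⊔ ltField π 0 : IntermediateField F (AlgebraicClosure F))) - 1‖ < 1} := by
    ext β
    simp only [mem_principalCoherentFamilies_iff, Set.mem_inter_iff, Set.mem_iInter, Set.mem_setOf_eq]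
  rw [e]
  refine (isClosed_iInter fun m => isClosed_eq ?_ (continuous_apply m)).inter (isClosed_iInter fun m => ?_)
  · exact (RelNormCoherentUnits.continuous_baseNorm hπ (hmono (Nat.le_succ m))).comp (continuous_apply (m + 1))
  · exact (isClosed_setOf_norm_sub_one_lt (E m ⊔ ltField π 0)).preimage
      ((RelNormCoherentUnits.continuous_val_apply hπ (E m) 0).comp (continuous_apply m))

omit [∀ m, Normal F (E m)] in
/-- ★ **`𝒰¹_∞` is COMPACT.** [cite: deShalit1987, Ch. I §3.8 (16)–(17); Ch. III §1.3] -/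
instance compactSpace_principalCoherentFamilies : CompactSpace (principalCoherentFamilies hπ E hmono) :=
  isCompact_iff_compactSpace.mp (isClosed_principalCoherentFamilies hπ E hmono).isCompact

omit [NeZero d] [IsAdicComplete (Ideal.span {(p : 𝒪[F])}) 𝒪[F]] in
/-- The congruence conditions `IsTransformProd` are CLOSED in `(β, G)`. [cite: deShalit1987, Ch. I §3.8 (17)] -/
theorem isClosed_setOf_isTransformProd :
    IsClosed {q : principalCoherentFamilies hπ E hmono × (ZMod d → ColemanCoordModule hπ hq (intBase F) u hu γ) |
      IsTransformProd p d hd σ₀ hθ (fun m => relUnitCoordTwo hπ (E m) hq (hE m) hσ₀ u hu (q.1.1 m)) (fun j => TActModule.toPS (q.2 j))} := by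
  have e : {q : principalCoherentFamilies hπ E hmono × (ZMod d → ColemanCoordModule hπ hq (intBase F) u hu γ) |
      IsTransformProd p d hd σ₀ hθ (fun m => relUnitCoordTwo hπ (E m) hq (hE m) hσ₀ u hu (q.1.1 m)) (fun j => TActModule.toPS (q.2 j))} =
      ⋂ m, ⋂ k, ⋂ (j : ZMod d), (fun q : principalCoherentFamilies hπ E hmono × (ZMod d → ColemanCoordModule hπ hq (intBase F) u hu γ) =>
        PowerSeries.coeff k (TActModule.toPS (q.2 j)) -
          amiceSum p d hd σ₀ (hθ m) (PowerSeries.coeff k (relUnitCoordTwo hπ (E m) hq (hE m) hσ₀ u hu (q.1.1 m))) j) ⁻¹'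
        {x : PowerSeries 𝒪[F] | ((1 + PowerSeries.X : PowerSeries 𝒪[F]) ^ p ^ m - 1) ∣ x} := by
    ext q
    simp only [Set.mem_setOf_eq, Set.mem_iInter, Set.mem_preimage, IsTransformProd, IsAmiceLevel]
  rw [e]
  refine isClosed_iInter fun m => isClosed_iInter fun k => isClosed_iInter fun j => (isClosed_setOf_dvd _).preimage ?_
  refine Continuous.sub ?_ ?_
  · exact (PowerSeries.WithPiTopology.continuous_coeff _ k).comp (TActModule.continuous_toPS.comp ((continuous_apply j).comp continuous_snd))
  · refine (continuous_amiceSum hd E σ₀ (hθ m) j).comp ?_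
    refine (PowerSeries.WithPiTopology.continuous_coeff _ k).comp ?_
    exact (continuous_relUnitCoordTwo hπ (E m) hq (hE m) hσ₀ u hu).comp ((continuous_apply m).comp (continuous_subtype_val.comp continuous_fst))

include hdeg in
/-- ★★ **The two-variable Coleman transform `Col : 𝒰¹_∞ → M` is CONTINUOUS** (closed graph: `G = Col β` iff the congruences
`IsTransformProd (r_{β_m})_m G`, which are closed; `M` compact). [cite: deShalit1987, Ch. I §3.4 Corollary, §3.7, §3.8 (17)] -/
theorem continuous_colemanImage :
    Continuous fun β : principalCoherentFamilies hπ E hmono => colemanImage hd hπ E hmono hE hdeg hσ₀ hq u hu γ hθ hcoh β.2.1 := by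
  refine continuous_of_isClosed_graph' (P := fun (β : principalCoherentFamilies hπ E hmono) (G : ZMod d → ColemanCoordModule hπ hq (intBase F) u hu γ) =>
    IsTransformProd p d hd σ₀ hθ (fun m => relUnitCoordTwo hπ (E m) hq (hE m) hσ₀ u hu (β.1 m)) (fun j => TActModule.toPS (G j))) ?_
    (isClosed_setOf_isTransformProd hd hπ E hmono hE hσ₀ hq u hu γ hθ)
  intro β G
  constructor
  · intro hG
    have h := toPS_colemanImage_eq_of_isTransformProd hd hπ E hmono hE hdeg hσ₀ hq u hu γ hθ hcoh β.2.1 hG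
    exact funext fun j => TActModule.toPS_injective (congrFun h j)
  · rintro rfl
    exact isTransformProd_colemanImage hd hπ E hmono hE hdeg hσ₀ hq u hu γ hθ hcoh β.2.1

variable [IsAdicComplete (Ideal.span {intBase F (LTCoeff.of F π)}) (PowerSeries 𝒪[F])]
  [CharZero F] (hI : Ideal.span {(p : 𝒪[F])} ≠ ⊤) (hud : ∀ m, (u : LTCoeff F) ^ Module.finrank F (E m) ≠ 1)
  (hm : ∃ m₁ : ℕ, LTCoeff.of F π ^ 2 ∣ LTCoeff.of F π - m₁)

include hdeg hm in
/-- `N = Col(𝒰¹_∞)` as sets. [cite: deShalit1987, Ch. I §3.7, §3.8 (17)] -/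
theorem coe_unitsImage_eq_range :
    (unitsImage hd hπ E hmono hE hdeg hσ₀ hq u hu γ hθ hcoh hI hud : Set (ZMod d → ColemanCoordModule hπ hq (intBase F) u hu γ)) =
      Set.range fun β : principalCoherentFamilies hπ E hmono => colemanImage hd hπ E hmono hE hdeg hσ₀ hq u hu γ hθ hcoh β.2.1 := by
  ext G
  rw [SetLike.mem_coe, Set.mem_range]
  constructor
  · intro hG
    obtain ⟨β, hβ, hβ1, hG'⟩ := exists_colemanImage_eq_of_mem_unitsImage hd hπ E hmono hE hdeg hσ₀ hq u hu γ hθ hcoh hI hud hm hG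
    exact ⟨⟨β, hβ, hβ1⟩, hG'⟩
  · rintro ⟨β, rfl⟩
    exact colemanImage_mem_unitsImage hd hπ E hmono hE hdeg hσ₀ hq u hu γ hθ hcoh hI hud hm β.2.1 β.2.2

include hm in
/-- ★★ **`N = unitsImage` is CLOSED in `M`** (the continuous image of the compact `𝒰¹_∞`); in particular `N` is compact.
[cite: deShalit1987, Ch. I §3.7 Theorem; Ch. III §1.3] -/
theorem isClosed_unitsImage :
    IsClosed (unitsImage hd hπ E hmono hE hdeg hσ₀ hq u hu γ hθ hcoh hI hud : Set (ZMod d → ColemanCoordModule hπ hq (intBase F) u hu γ)) := by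
  rw [coe_unitsImage_eq_range hd hπ E hmono hE hdeg hσ₀ hq u hu γ hθ hcoh hI hud hm]
  exact (isCompact_range (continuous_colemanImage hd hπ E hmono hE hdeg hσ₀ hq u hu γ hθ hcoh)).isClosed

include hm in
/-- `N` is compact. [cite: deShalit1987, Ch. I §3.7 Theorem] -/
theorem compactSpace_unitsImage : CompactSpace (unitsImage hd hπ E hmono hE hdeg hσ₀ hq u hu γ hθ hcoh hI hud) :=
  isCompact_iff_compactSpace.mp (isClosed_unitsImage hd hπ E hmono hE hdeg hσ₀ hq u hu γ hθ hcoh hI hud hm).isCompact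

include hm in
/-- `colemanImageEquiv` is continuous. [cite: deShalit1987, Ch. I §3.4 Corollary, §3.7] -/
theorem continuous_colemanImageEquiv : Continuous (colemanImageEquiv hd hπ E hmono hE hdeg hσ₀ hq u hu γ hθ hcoh hI hud hm) :=
  Continuous.subtype_mk (continuous_colemanImage hd hπ E hmono hE hdeg hσ₀ hq u hu γ hθ hcoh) _

include hm in
/-- ★★★ **`Col : 𝒰¹_∞ ≃ₜ N` — de Shalit's `i` is a HOMEOMORPHISM onto its (closed) image** (a continuous bijection from a compact space
to a Hausdorff space). [cite: deShalit1987, Ch. I §3.7 Theorem; Ch. III §1.3] [cite: BourbakiGT1, Ch. I §9.4 Cor. 2] -/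
def colemanImageHomeomorph : principalCoherentFamilies hπ E hmono ≃ₜ unitsImage hd hπ E hmono hE hdeg hσ₀ hq u hu γ hθ hcoh hI hud :=
  (continuous_colemanImageEquiv hd hπ E hmono hE hdeg hσ₀ hq u hu γ hθ hcoh hI hud hm).homeoOfEquivCompactToT2

include hm in
/-- The homeomorphism is `colemanImageEquiv` (unfolding). [cite: deShalit1987, Ch. I §3.7] -/
@[simp] theorem colemanImageHomeomorph_apply (β : principalCoherentFamilies hπ E hmono) :
    colemanImageHomeomorph hd hπ E hmono hE hdeg hσ₀ hq u hu γ hθ hcoh hI hud hm β =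
      colemanImageEquiv hd hπ E hmono hE hdeg hσ₀ hq u hu γ hθ hcoh hI hud hm β := rfl

omit [IsAdicComplete (Ideal.span {intBase F (LTCoeff.of F π)}) (PowerSeries 𝒪[F])] [CharZero F] in
/-- **Images of closed sets of `𝒰¹_∞` are closed in `M`** (`Col` is a closed map onto the closed `N`). [cite: deShalit1987, Ch. III §1.4] -/
theorem isClosed_image_colemanImage {C : Set (principalCoherentFamilies hπ E hmono)} (hC : IsClosed C) :
    IsClosed ((fun β : principalCoherentFamilies hπ E hmono => colemanImage hd hπ E hmono hE hdeg hσ₀ hq u hu γ hθ hcoh β.2.1) '' C) :=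
  (hC.isCompact.image (continuous_colemanImage hd hπ E hmono hE hdeg hσ₀ hq u hu γ hθ hcoh)).isClosed

end Coleman

/-! ### §4. Closed subgroups of `M` stable under `σ_γ`, `C(1+X)•` and `ℕ` are `Λ`-submodules -/

section ClosedSubmodules

variable {π : 𝒪[F]} (hπ : (valuation F).IsUniformizer (π : F)) (hq : residueFieldCard F = 2)
variable (u : (LTCoeff F)ˣ) (hu : LTCoeff.of F π = residueFieldCard F * u) (γ : 𝒪[F]ˣ) {d : ℕ}
variable [IsAdicComplete (Ideal.span {intBase F (LTCoeff.of F π)}) (PowerSeries 𝒪[F])]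

/-- **`ℕ` dense in `𝒪_F` ⇒ constants `C (C a)` preserve every closed subgroup** (`(C (C n)) • G = n • G`). [cite: Washington1997, §13.2] -/
theorem CC_smul_mem_of_denseRange_natCast (hN : DenseRange (Nat.cast : ℕ → 𝒪[F]))
    {Z : AddSubgroup (ZMod d → ColemanCoordModule hπ hq (intBase F) u hu γ)} (hZ : IsClosed (Z : Set (ZMod d → ColemanCoordModule hπ hq (intBase F) u hu γ))) (a : 𝒪[F])
    {G : ZMod d → ColemanCoordModule hπ hq (intBase F) u hu γ} (hG : G ∈ Z) :
    (PowerSeries.C (PowerSeries.C a) : PowerSeries (PowerSeries 𝒪[F])) • G ∈ Z := by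
  have hcont : Continuous fun a : 𝒪[F] => (PowerSeries.C (PowerSeries.C a) : PowerSeries (PowerSeries 𝒪[F])) • G :=
    ((PowerSeries.WithPiTopology.continuous_C (R := PowerSeries 𝒪[F])).comp (PowerSeries.WithPiTopology.continuous_C (R := 𝒪[F]))).smul
      continuous_const
  have h1 : (fun a : 𝒪[F] => (PowerSeries.C (PowerSeries.C a) : PowerSeries (PowerSeries 𝒪[F])) • G) '' Set.range (Nat.cast : ℕ → 𝒪[F]) ⊆ (Z : Set (ZMod d → ColemanCoordModule hπ hq (intBase F) u hu γ)) := by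
    rintro _ ⟨_, ⟨n, rfl⟩, rfl⟩
    change (PowerSeries.C (PowerSeries.C (n : 𝒪[F])) : PowerSeries (PowerSeries 𝒪[F])) • G ∈ Z
    rw [map_natCast, map_natCast, Nat.cast_smul_eq_nsmul]
    exact Z.nsmul_mem hG n
  have h2 := hcont.range_subset_closure_image_dense hN ⟨a, rfl⟩
  have h3 := closure_mono h1 h2
  rwa [hZ.closure_eq] at h3

/-- ★★★ **A CLOSED subgroup `Z ≤ M` stable under `σ_γ` (`= (1+T)•`), under `C(1+X)•` (`φ`) and — automatically — under `ℕ` is a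
`Λ = 𝒪_F⟦X⟧⟦T⟧`-SUBMODULE, provided `ℕ` is dense in `𝒪_F` (`F` of degree one over `ℚ_p`).**  This is how the image under `Col` of a
closed Galois-stable subgroup of `𝒰¹_∞` (e.g. the closure of the elliptic units) is a `Λ`-submodule. [cite: deShalit1987, Ch. III §1.4]
[cite: Washington1997, §13.2] -/
theorem smul_mem_of_isClosed_of_ops (hN : DenseRange (Nat.cast : ℕ → 𝒪[F]))
    {Z : AddSubgroup (ZMod d → ColemanCoordModule hπ hq (intBase F) u hu γ)} (hZ : IsClosed (Z : Set (ZMod d → ColemanCoordModule hπ hq (intBase F) u hu γ)))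
    (hγ : ∀ G ∈ Z, (fun j => unitTwistₗ hπ hq (intBase F) u hu γ γ (G j)) ∈ Z)
    (hφ : ∀ G ∈ Z, (PowerSeries.C (1 + PowerSeries.X) : PowerSeries (PowerSeries 𝒪[F])) • G ∈ Z)
    (c : PowerSeries (PowerSeries 𝒪[F])) {G : ZMod d → ColemanCoordModule hπ hq (intBase F) u hu γ} (hG : G ∈ Z) : c • G ∈ Z := by
  have hcont : ∀ z : ZMod d → ColemanCoordModule hπ hq (intBase F) u hu γ, Continuous fun c : PowerSeries (PowerSeries 𝒪[F]) => c • z :=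
    fun z => continuous_smul_left_pi hπ hq u hu γ z
  -- `T•`-stability from `σ_γ = (1 + T)•`
  have hX : ∀ z ∈ Z, (PowerSeries.X : PowerSeries (PowerSeries 𝒪[F])) • z ∈ Z := by
    intro z hz
    have h1 : ((1 + PowerSeries.X : PowerSeries (PowerSeries 𝒪[F]))) • z ∈ Z := by
      have e : ((1 + PowerSeries.X : PowerSeries (PowerSeries 𝒪[F]))) • z = fun j => unitTwistₗ hπ hq (intBase F) u hu γ γ (z j) := by
        funext j
        rw [Pi.smul_apply, unitTwistₗ_self]
      rw [e]; exact hγ z hz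
    exact (X_smul_mem_iff_one_add_X_smul_mem hz).mpr h1
  -- constants: `C (C a)` by density of `ℕ`, `C X` from `C (1 + X)`, all `C s` by density of polynomials
  have hCC : ∀ (a : 𝒪[F]), ∀ z ∈ Z, (PowerSeries.C (PowerSeries.C a) : PowerSeries (PowerSeries 𝒪[F])) • z ∈ Z :=
    fun a z hz => CC_smul_mem_of_denseRange_natCast hπ hq u hu γ hN hZ a hz
  have hCX : ∀ z ∈ Z, (PowerSeries.C PowerSeries.X : PowerSeries (PowerSeries 𝒪[F])) • z ∈ Z := by
    intro z hz
    have e : (PowerSeries.C PowerSeries.X : PowerSeries (PowerSeries 𝒪[F])) • z =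
        (PowerSeries.C (1 + PowerSeries.X) : PowerSeries (PowerSeries 𝒪[F])) • z - z := by
      rw [map_add, map_one, add_smul, one_smul, add_sub_cancel_left]
    rw [e]
    exact Z.sub_mem (hφ z hz) hz
  have hC : ∀ (s : PowerSeries 𝒪[F]), ∀ z ∈ Z, (PowerSeries.C s : PowerSeries (PowerSeries 𝒪[F])) • z ∈ Z :=
    fun s z hz => C_smul_mem_of_isClosed_twoVariable hZ
      (fun z => (hcont z).comp (PowerSeries.WithPiTopology.continuous_C (R := PowerSeries 𝒪[F]))) hCC hCX s hz
  exact smul_mem_of_isClosed hZ hcont hC hX c hG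

/-- The `Λ`-submodule structure on such a closed subgroup. [cite: deShalit1987, Ch. III §1.4] [cite: Washington1997, §13.2] -/
def submoduleOfIsClosedOfOps (hN : DenseRange (Nat.cast : ℕ → 𝒪[F]))
    (Z : AddSubgroup (ZMod d → ColemanCoordModule hπ hq (intBase F) u hu γ)) (hZ : IsClosed (Z : Set (ZMod d → ColemanCoordModule hπ hq (intBase F) u hu γ)))
    (hγ : ∀ G ∈ Z, (fun j => unitTwistₗ hπ hq (intBase F) u hu γ γ (G j)) ∈ Z)
    (hφ : ∀ G ∈ Z, (PowerSeries.C (1 + PowerSeries.X) : PowerSeries (PowerSeries 𝒪[F])) • G ∈ Z) :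
    Submodule (PowerSeries (PowerSeries 𝒪[F])) (ZMod d → ColemanCoordModule hπ hq (intBase F) u hu γ) where
  carrier := Z
  add_mem' := Z.add_mem
  zero_mem' := Z.zero_mem
  smul_mem' c _ hG := smul_mem_of_isClosed_of_ops hπ hq u hu γ hN hZ hγ hφ c hG

/-- Its carrier is `Z`. [cite: deShalit1987, Ch. III §1.4] -/
@[simp] theorem mem_submoduleOfIsClosedOfOps {hN : DenseRange (Nat.cast : ℕ → 𝒪[F])}
    {Z : AddSubgroup (ZMod d → ColemanCoordModule hπ hq (intBase F) u hu γ)} {hZ : IsClosed (Z : Set (ZMod d → ColemanCoordModule hπ hq (intBase F) u hu γ))}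
    {hγ : ∀ G ∈ Z, (fun j => unitTwistₗ hπ hq (intBase F) u hu γ γ (G j)) ∈ Z}
    {hφ : ∀ G ∈ Z, (PowerSeries.C (1 + PowerSeries.X) : PowerSeries (PowerSeries 𝒪[F])) • G ∈ Z}
    {G : ZMod d → ColemanCoordModule hπ hq (intBase F) u hu γ} :
    G ∈ submoduleOfIsClosedOfOps hπ hq u hu γ hN Z hZ hγ hφ ↔ G ∈ Z := Iff.rfl

end ClosedSubmodules

end UnitsImageTopologyTwo

end Literature.NumberTheory.GaloisRepresentations
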